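import Mathlib
import Literature.AlgebraicGeometry.Resolution.CobordantGame
import Summits.ResolutionOfSingularities.ResolutionOfSingularities.Theorems.WeightedInvariantLocalWeightedDropMonicRecentre
import Summits.ResolutionOfSingularities.ResolutionOfSingularities.Theorems.WeightedInvariantLocalWeightedDropInsepCleaning
import Summits.ResolutionOfSingularities.ResolutionOfSingularities.Theorems.WeightedInvariantLocalWeightedDropSepTerminalDoublePointsDim

/-!
# `WeightedInvariant.LocalWeightedDrop`: terminal double points UP TO RE-CENTRING (cleaning), every dimension

Crux item stmt-ResolutionOfSingularities-8899 `LocalWeightedDrop` (route `ResolutionOfSingularities/WeightedInvariant`), skeleton v30,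
residual stubs W4|₄ / W4|₅₊ (`d = 2` slice: char-2 monic double points).  [OURS · L1 W4.3, chain w43, stub worker 4 (gen 4): the
dimension-generic twins of stub worker 3's `InsepDoublePoint.won_dp_add_sq_iff` / `won_dp_cleanSeries_iff` (`m = 1` only), glued to the
terminal theorems `TerminalDoublePointDim.terminalDoublePointWon` / `SepTerminalDoublePointDim.sepTerminalDoublePointWon`; NOT a statement of
any manuscript.]

* `won_dp1_recentre_iff_charTwo` (characteristic `2`, every dimension): re-centring `y ↦ y + φ` (`φ(0) = 0`) turns `y² + A₁ y + A₀` into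
  `y² + A₁ y + (A₀ + A₁ φ + φ²)` — the two are won together (`won_monic_two_recentre_iff` with `2φ = 0`); `won_dp_add_sq_iff'` is the case
  `A₁ = 0`: the purely inseparable position is `A₀` MODULO SQUARES;
* `won_dp_cleanSeries_iff'` (characteristic `2`, `k` algebraically closed, every dimension): `y² + cleanSeries 2 A₀` is won iff `y² + A₀` is;
* `won_dp_of_cleanSeries_terminal`, `won_dp1_of_recentre_terminal`: a double point whose CLEANED (resp. RE-CENTRED) coefficients are terminal
  is won — the form in which the terminal layer is met inside a reduction game.
-/

set_option linter.dupNamespace false -- mandated namespace of this single-conjunct summit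

namespace Summit.ResolutionOfSingularities.ResolutionOfSingularities.Theorems

open Literature.AlgebraicGeometry.Resolution
open Literature.AlgebraicGeometry.Resolution.CobordantGame

namespace TerminalDoublePointDim

open MvPowerSeries

variable {k : Type} [Field k] {m : ℕ}

/-- RE-CENTRING IN CHARACTERISTIC `2` (every dimension): `y² + A₁ y + (A₀ + A₁ φ + φ²)` is won iff `y² + A₁ y + A₀` is (`φ(0) = 0`). -/
theorem won_dp1_recentre_iff_charTwo [CharP k 2] (φ : MvPowerSeries (Fin (m + 1)) k) (hφ : constantCoeff φ = 0)
    (A₀ A₁ : MvPowerSeries (Fin (m + 1)) k) :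
    CobordantGame.Won k (m + 1 + 1) (X (Fin.last (m + 1)) ^ 2 +
        (rename (Fin.succAboveEmb (Fin.last (m + 1))) (A₀ + A₁ * φ + φ ^ 2) +
          rename (Fin.succAboveEmb (Fin.last (m + 1))) A₁ * X (Fin.last (m + 1)))) ↔
      CobordantGame.Won k (m + 1 + 1) (X (Fin.last (m + 1)) ^ 2 +
        (rename (Fin.succAboveEmb (Fin.last (m + 1))) A₀ + rename (Fin.succAboveEmb (Fin.last (m + 1))) A₁ * X (Fin.last (m + 1)))) := by
  have h := won_monic_two_recentre_iff (m := m + 1) φ hφ A₀ A₁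
  haveI : CharP (MvPowerSeries (Fin (m + 1)) k) 2 := charP_of_injective_algebraMap (C_injective (σ := Fin (m + 1)) (R := k)) 2
  have h2 : (2 : MvPowerSeries (Fin (m + 1)) k) * φ = 0 := by
    rw [show (2 : MvPowerSeries (Fin (m + 1)) k) = 0 from CharTwo.two_eq_zero, zero_mul]
  rwa [h2, add_zero] at h

/-- THE PURELY INSEPARABLE POSITION IS `A₀` MODULO SQUARES (characteristic `2`, every dimension): `y² + (A₀ + φ²)` is won iff `y² + A₀`
is (`φ(0) = 0`). -/
theorem won_dp_add_sq_iff' [CharP k 2] (φ : MvPowerSeries (Fin (m + 1)) k) (hφ : constantCoeff φ = 0)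
    (A₀ : MvPowerSeries (Fin (m + 1)) k) :
    CobordantGame.Won k (m + 1 + 1) (X (Fin.last (m + 1)) ^ 2 + rename (Fin.succAboveEmb (Fin.last (m + 1))) (A₀ + φ ^ 2)) ↔
      CobordantGame.Won k (m + 1 + 1) (X (Fin.last (m + 1)) ^ 2 + rename (Fin.succAboveEmb (Fin.last (m + 1))) A₀) := by
  have h := won_dp1_recentre_iff_charTwo φ hφ A₀ 0
  simpa only [zero_mul, add_zero, map_zero] using h

/-- CLEANING (characteristic `2`, `k` algebraically closed, every dimension): for `A₀(0) = 0`, `y² + cleanSeries 2 A₀` is won iff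
`y² + A₀` is won. -/
theorem won_dp_cleanSeries_iff' [CharP k 2] [IsAlgClosed k] (A₀ : MvPowerSeries (Fin (m + 1)) k) (h0 : constantCoeff A₀ = 0) :
    CobordantGame.Won k (m + 1 + 1) (X (Fin.last (m + 1)) ^ 2 +
        rename (Fin.succAboveEmb (Fin.last (m + 1))) (HauserPerlega2024.cleanSeries 2 A₀)) ↔
      CobordantGame.Won k (m + 1 + 1) (X (Fin.last (m + 1)) ^ 2 + rename (Fin.succAboveEmb (Fin.last (m + 1))) A₀) := by
  obtain ⟨φ, hφ0, heq⟩ := InsepCleaning.exists_cleanSeries_two_eq_add_sq A₀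
  rw [h0] at hφ0
  rw [heq]
  exact won_dp_add_sq_iff' φ (pow_eq_zero_iff two_ne_zero |>.mp hφ0) A₀

/-- **TERMINAL AFTER CLEANING** (characteristic `2`, `k` algebraically closed, every dimension): if the cleaned coefficient
`cleanSeries 2 A₀` (`A₀(0) = 0`) is terminal — `x^μ U` with `μ ∉ 2ℕ^{m+1}`, `U(0) ≠ 0`, or `x^{2μ} g` with `ord g = 1` — then `y² + A₀` is won. -/
theorem won_dp_of_cleanSeries_terminal [CharP k 2] [IsAlgClosed k] (A₀ : MvPowerSeries (Fin (m + 1)) k) (h0 : constantCoeff A₀ = 0)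
    (hT : (∃ (μ : Fin (m + 1) → ℕ) (U : MvPowerSeries (Fin (m + 1)) k), constantCoeff U ≠ 0 ∧ ¬ (∀ l, 2 ∣ μ l) ∧
        HauserPerlega2024.cleanSeries 2 A₀ = (∏ l, X l ^ μ l) * U) ∨
      (∃ (μ : Fin (m + 1) → ℕ) (g : MvPowerSeries (Fin (m + 1)) k), g.order = 1 ∧
        HauserPerlega2024.cleanSeries 2 A₀ = (∏ l, X l ^ (2 * μ l)) * g)) :
    CobordantGame.Won k (m + 1 + 1) (X (Fin.last (m + 1)) ^ 2 + rename (Fin.succAboveEmb (Fin.last (m + 1))) A₀) :=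
  (won_dp_cleanSeries_iff' A₀ h0).mp (terminalDoublePointWon 2 Nat.prime_two k _ hT)

/-- **TERMINAL AFTER RE-CENTRING** (characteristic `2`, every field, every dimension): if for some `φ` with `φ(0) = 0` the re-centred pair
`(A₀ + A₁ φ + φ², A₁)` has one of the separable terminal shapes (M1)/(M2)/(SR) of `SepTerminalDoublePointDim.sepTerminalDoublePointWon`, then
`y² + A₁ y + A₀` is won. -/
theorem won_dp1_of_recentre_terminal [CharP k 2] (A₀ A₁ φ : MvPowerSeries (Fin (m + 1)) k) (hφ : constantCoeff φ = 0)
    (hT : (∃ (μ : Fin (m + 1) → ℕ) (U B : MvPowerSeries (Fin (m + 1)) k), constantCoeff U ≠ 0 ∧ ¬ (∀ l, 2 ∣ μ l) ∧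
          A₀ + A₁ * φ + φ ^ 2 = (∏ l, X l ^ μ l) * U ∧ A₁ = (∏ l, X l ^ ((μ l + 1) / 2)) * B) ∨
      (∃ (ν : Fin (m + 1) → ℕ) (V W : MvPowerSeries (Fin (m + 1)) k), constantCoeff V ≠ 0 ∧
          A₁ = (∏ l, X l ^ ν l) * V ∧ A₀ + A₁ * φ + φ ^ 2 = (∏ l, X l ^ (2 * ν l)) * W) ∨
      (∃ (μ : Fin (m + 1) → ℕ) (g B : MvPowerSeries (Fin (m + 1)) k), g.order = 1 ∧
          A₀ + A₁ * φ + φ ^ 2 = (∏ l, X l ^ (2 * μ l)) * g ∧ A₁ = (∏ l, X l ^ μ l) * B)) :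
    CobordantGame.Won k (m + 1 + 1) (X (Fin.last (m + 1)) ^ 2 +
      (rename (Fin.succAboveEmb (Fin.last (m + 1))) A₀ + rename (Fin.succAboveEmb (Fin.last (m + 1))) A₁ * X (Fin.last (m + 1)))) :=
  (won_dp1_recentre_iff_charTwo φ hφ A₀ A₁).mp (SepTerminalDoublePointDim.sepTerminalDoublePointWon k _ A₁ hT)

end TerminalDoublePointDim

end Summit.ResolutionOfSingularities.ResolutionOfSingularities.Theorems
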